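import Mathlib
import Summits.MatrixMultiplication.MatrixMultiplication.Theses.MatrixPointInterpolation
import Literature.Algebra.PolynomialIdentities.GenericMatricesGrowth

/-!
# `MatrixPointInterpolation.TightWindows` (stmt-MatrixMultiplication-18939) — Negative lane, part 1:
# the window dimension is unbounded; witness pairs

Support lemmas for the load-bearing analysis of the crux `TightWindows` (crux disprover,
`Cruxes/TightWindows/Disproof.lean`; consumed by `Negative/LoadBearingHypotheses.lean`):

* `succ_le_finrank_wordFun` — `wordDim k D ≥ D + 1`: the span of the word-functions of length `≤ D`
  on pairs of `k × k` matrices (`k ≥ 1`; verbatim the set in the crux's conclusion, i.e.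
  `Literature…genericWordDim k D`) contains the `D + 1` independent power functions `B ↦ (B 0)^m`
  (`linearIndependent_powFun`: evaluate at scalar pairs `t • 1`; a complex polynomial vanishing at
  every `t` is zero).  So the crux's bound, a function of `(k, d)` alone, is violated as soon as `d`
  may grow with `n` fixed — which each dropped hypothesis permits.
* witnesses: the matrix units `(E₀₁, E₁₀)` generate `M₂(ℂ)` in degree `2` (`unitPair_gen`); the
  pair (shift `N`, corner unit `E_{last,0}`) generates `M_{n+1}(ℂ)` in degree `2n + 1`
  (`shiftPair_gen`, via `E_{ij} = N^{n-i} E_{last,0} N^{j}`, `shift_word_eq_single`; `N` enters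
  through its entries `hN`, instantiated by `Matrix.of`); a pair of `k × k` matrices masquerades as
  `M_k` trivially (`masq_self`), and the scalar pair `(1, 1) ∈ M_n(ℂ)²` masquerades as every `M_k`,
  `k ≥ 1` (`masq_one`: an identity of `M_k` has coefficient sum zero).
-/

namespace Summit.MatrixMultiplication.MatrixMultiplication.Theorems

namespace TightWindowsNeg

open Summit.MatrixMultiplication.MatrixMultiplication.Theses.MatrixPointInterpolation

/-- The power word-functions `B ↦ (B 0)^m`, `m ≤ D`, are linearly independent (evaluate at scalar
pairs `t • 1` and read off a polynomial in `t` with infinitely many roots). [folklore] -/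
theorem linearIndependent_powFun (k D : ℕ) (hk : 0 < k) :
    LinearIndependent ℂ (fun m : Fin (D + 1) =>
      (fun B : Fin 2 → Matrix (Fin k) (Fin k) ℂ => (B 0) ^ (m : ℕ))) := by
  rw [linearIndependent_iff']
  intro s g hsum i hi
  have key : ∀ t : ℂ, ∑ m ∈ s, g m * t ^ (m : ℕ) = 0 := by
    intro t
    have h1 := congr_fun hsum (fun _ => t • (1 : Matrix (Fin k) (Fin k) ℂ))
    simp only [Finset.sum_apply, Pi.smul_apply, Pi.zero_apply] at h1
    have h2 := congr_fun (congr_fun h1 ⟨0, hk⟩) ⟨0, hk⟩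
    simp only [Matrix.sum_apply, Matrix.smul_apply, smul_eq_mul, Matrix.zero_apply] at h2
    rw [← h2]
    refine Finset.sum_congr rfl fun m _ => ?_
    rw [smul_pow, one_pow, Matrix.smul_apply, Matrix.one_apply_eq, smul_eq_mul, mul_one]
  set P : Polynomial ℂ := ∑ m ∈ s, Polynomial.C (g m) * Polynomial.X ^ (m : ℕ) with hP
  have hP0 : P = 0 := by
    apply Polynomial.funext
    intro t
    simp only [hP, Polynomial.eval_finsetSum, Polynomial.eval_mul, Polynomial.eval_C,
      Polynomial.eval_pow, Polynomial.eval_X, Polynomial.eval_zero]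
    exact key t
  have hcoeff : P.coeff (i : ℕ) = g i := by
    simp only [hP, Polynomial.finsetSum_coeff, Polynomial.coeff_C_mul, Polynomial.coeff_X_pow]
    rw [Finset.sum_eq_single i]
    · simp
    · intro m _ hmi
      have : (i : ℕ) ≠ (m : ℕ) := fun h => hmi (Fin.ext h).symm
      simp [this]
    · intro his
      exact absurd hi his
  rw [hP0, Polynomial.coeff_zero] at hcoeff
  exact hcoeff.symm

/-- **The window dimension is unbounded in the degree**: the span of the word-functions of
length `≤ D` on pairs of `k × k` matrices (`k ≥ 1`) has dimension `≥ D + 1`. [folklore] -/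
theorem succ_le_finrank_wordFun (k D : ℕ) (hk : 0 < k) :
    D + 1 ≤ Module.finrank ℂ (Submodule.span ℂ
      {f : (Fin 2 → Matrix (Fin k) (Fin k) ℂ) → Matrix (Fin k) (Fin k) ℂ |
        ∃ w : List (Fin 2), w.length ≤ D ∧ f = fun B => (w.map B).prod}) := by
  haveI := Literature.Algebra.PolynomialIdentities.finite_span_wordMaps k D
  have h1 := finrank_span_eq_card (linearIndependent_powFun k D hk)
  rw [Fintype.card_fin] at h1
  rw [← h1]
  apply Submodule.finrank_mono
  apply Submodule.span_mono
  rintro f ⟨m, rfl⟩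
  refine ⟨List.replicate (m : ℕ) 0, by simp; omega, ?_⟩
  funext B
  simp [List.map_replicate, List.prod_replicate]

/-! ## The witness pair of matrix units in `M₂(ℂ)` -/

/-- `(E₀₁, E₁₀)` generates `M₂(ℂ)` by words of length `≤ 2`:
`E₀₀ = E₀₁E₁₀`, `E₁₁ = E₁₀E₀₁`. [folklore] -/
theorem unitPair_gen {d : ℕ} (hd : 2 ≤ d) :
    Submodule.span ℂ {M : Matrix (Fin 2) (Fin 2) ℂ |
      ∃ w : List (Fin 2), w.length ≤ d ∧ (w.map (![Matrix.single 0 1 1, Matrix.single 1 0 1] : Fin 2 → Matrix (Fin 2) (Fin 2) ℂ)).prod = M} = ⊤ := by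
  rw [eq_top_iff]
  rintro M -
  rw [Matrix.matrix_eq_sum_single M]
  refine Submodule.sum_mem _ fun i _ => Submodule.sum_mem _ fun j _ => ?_
  have : Matrix.single i j (M i j) = (M i j) • Matrix.single i j (1 : ℂ) := by
    rw [Matrix.smul_single, smul_eq_mul, mul_one]
  rw [this]
  refine Submodule.smul_mem _ _ (Submodule.subset_span ?_)
  fin_cases i <;> fin_cases j
  · exact ⟨[0, 1], by simp; omega, by simp⟩
  · exact ⟨[0], by simp; omega, by simp⟩
  · exact ⟨[1], by simp; omega, by simp⟩
  · exact ⟨[1, 0], by simp; omega, by simp⟩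

/-- A pair of `k × k` matrices trivially masquerades as `M_k` (to every degree). [folklore] -/
theorem masq_self {k D : ℕ} (A : Fin 2 → Matrix (Fin k) (Fin k) ℂ) :
    ∀ (T : Finset (List (Fin 2))) (c : List (Fin 2) → ℂ), (∀ w ∈ T, w.length ≤ D) →
      (∀ B : Fin 2 → Matrix (Fin k) (Fin k) ℂ, (∑ w ∈ T, c w • (w.map B).prod) = 0) →
      (∑ w ∈ T, c w • (w.map A).prod) = 0 :=
  fun _ _ _ hB => hB A

/-- A scalar pair `(1, 1)` in `M_n(ℂ)` masquerades as `M_k` (`k ≥ 1`) to every degree: an identity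
of `M_k` has coefficient sum `0` (evaluate at `(1, 1)`). [folklore] -/
theorem masq_one {k n D : ℕ} (hk : 0 < k) :
    ∀ (T : Finset (List (Fin 2))) (c : List (Fin 2) → ℂ), (∀ w ∈ T, w.length ≤ D) →
      (∀ B : Fin 2 → Matrix (Fin k) (Fin k) ℂ, (∑ w ∈ T, c w • (w.map B).prod) = 0) →
      (∑ w ∈ T, c w • (w.map (fun _ : Fin 2 => (1 : Matrix (Fin n) (Fin n) ℂ))).prod) = 0 := by
  intro T c _ hB
  have h1 : ∀ (m : ℕ) (w : List (Fin 2)),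
      (w.map (fun _ : Fin 2 => (1 : Matrix (Fin m) (Fin m) ℂ))).prod = 1 := by
    intro m w
    induction w with
    | nil => simp
    | cons a w ih => simp
  have h2 := hB (fun _ => 1)
  simp only [h1] at h2 ⊢
  rw [← Finset.sum_smul] at h2 ⊢
  have h3 := congr_fun (congr_fun h2 ⟨0, hk⟩) ⟨0, hk⟩
  simp only [Matrix.smul_apply, Matrix.one_apply_eq, smul_eq_mul, mul_one, Matrix.zero_apply] at h3
  rw [h3, zero_smul]

/-! ## A generating pair of `M_{n+1}(ℂ)` for every `n`: the shift and a corner unit -/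

/-- Entries of the powers of the shift: `(N^a) i j = 1` iff `j = i + a`. [folklore] -/
theorem shiftMat_pow_apply {n : ℕ} (N : Matrix (Fin n) (Fin n) ℂ)
    (hN : ∀ i j : Fin n, N i j = if (j : ℕ) = (i : ℕ) + 1 then 1 else 0) (a : ℕ) (i j : Fin n) :
    (N ^ a) i j = if (j : ℕ) = (i : ℕ) + a then 1 else 0 := by
  induction a generalizing i j with
  | zero => simp [Matrix.one_apply, Fin.ext_iff, eq_comm]
  | succ a ih =>
    rw [pow_succ, Matrix.mul_apply]
    simp only [ih, hN]
    by_cases h : (i : ℕ) + a < n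
    · rw [Finset.sum_eq_single ⟨(i : ℕ) + a, h⟩]
      · simp [add_assoc]
      · intro l _ hl
        have : (l : ℕ) ≠ (i : ℕ) + a := fun e => hl (Fin.ext e)
        simp [this]
      · intro habs
        exact absurd (Finset.mem_univ _) habs
    · rw [Finset.sum_eq_zero]
      · have hj := j.isLt
        have : (j : ℕ) ≠ (i : ℕ) + (a + 1) := by omega
        simp [this]
      · intro l _
        have hl := l.isLt
        have : (l : ℕ) ≠ (i : ℕ) + a := by omega
        simp [this]

/-- `E_{last,0} · N^b` has a single non-zero row (the last), equal to `e_b`. [folklore] -/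
theorem corner_mul_pow_apply {n : ℕ} (N : Matrix (Fin (n + 1)) (Fin (n + 1)) ℂ)
    (hN : ∀ i j : Fin (n + 1), N i j = if (j : ℕ) = (i : ℕ) + 1 then 1 else 0)
    (b : ℕ) (l q : Fin (n + 1)) :
    (Matrix.single (Fin.last n) (0 : Fin (n + 1)) (1 : ℂ) * N ^ b) l q =
      if l = Fin.last n ∧ (q : ℕ) = b then 1 else 0 := by
  rw [Matrix.mul_apply]
  by_cases hl : l = Fin.last n
  · subst hl
    rw [Finset.sum_eq_single (0 : Fin (n + 1))]
    · rw [shiftMat_pow_apply N hN]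
      simp
    · intro m _ hm
      simp [Matrix.single, hm.symm]  -- hmm
    · intro habs
      exact absurd (Finset.mem_univ _) habs
  · rw [Finset.sum_eq_zero]
    · simp [hl]
    · intro m _
      have : ¬ (Fin.last n = l ∧ (0 : Fin (n + 1)) = m) := fun h => hl h.1.symm
      simp [Matrix.single, this]

/-- The words `N^{n-i} · E_{last,0} · N^{j}` are the matrix units `E_{ij}`. [folklore] -/
theorem shift_word_eq_single {n : ℕ} (N : Matrix (Fin (n + 1)) (Fin (n + 1)) ℂ)
    (hN : ∀ i j : Fin (n + 1), N i j = if (j : ℕ) = (i : ℕ) + 1 then 1 else 0) (i j : Fin (n + 1)) :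
    N ^ (n - (i : ℕ)) * (Matrix.single (Fin.last n) (0 : Fin (n + 1)) (1 : ℂ) * N ^ (j : ℕ)) =
      Matrix.single i j 1 := by
  ext p q
  rw [Matrix.mul_apply, Finset.sum_eq_single (Fin.last n)]
  · rw [corner_mul_pow_apply N hN, shiftMat_pow_apply N hN, Matrix.single_apply]
    have hi := i.isLt
    by_cases h1 : i = p
    · subst h1
      rw [Fin.val_last, if_pos (show (n : ℕ) = (i : ℕ) + (n - (i : ℕ)) by omega), one_mul]
      by_cases h2 : j = q
      · subst h2; simp
      · have : (q : ℕ) ≠ (j : ℕ) := fun e => h2 (Fin.ext e).symm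
        simp [this, h2]
    · rw [Fin.val_last, if_neg (show (n : ℕ) ≠ (p : ℕ) + (n - (i : ℕ)) by
        intro e; exact h1 (Fin.ext (by omega))), zero_mul]
      simp [h1]
  · intro l _ hl
    rw [corner_mul_pow_apply N hN]
    simp [hl]
  · intro habs
    exact absurd (Finset.mem_univ _) habs

/-- `(N, E_{last,0})` generates `M_{n+1}(ℂ)` by words of length `≤ 2n + 1`
(`E_{ij} = N^{n-i} E_{last,0} N^{j}`). [folklore] -/
theorem shiftPair_gen {n : ℕ} (N : Matrix (Fin (n + 1)) (Fin (n + 1)) ℂ)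
    (hN : ∀ i j : Fin (n + 1), N i j = if (j : ℕ) = (i : ℕ) + 1 then 1 else 0)
    {d : ℕ} (hd : 2 * n + 1 ≤ d) :
    Submodule.span ℂ {M : Matrix (Fin (n + 1)) (Fin (n + 1)) ℂ |
      ∃ w : List (Fin 2), w.length ≤ d ∧
        (w.map (![N, Matrix.single (Fin.last n) 0 1] : Fin 2 → Matrix (Fin (n + 1)) (Fin (n + 1)) ℂ)).prod
          = M} = ⊤ := by
  rw [eq_top_iff]
  rintro M -
  rw [Matrix.matrix_eq_sum_single M]
  refine Submodule.sum_mem _ fun i _ => Submodule.sum_mem _ fun j _ => ?_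
  have : Matrix.single i j (M i j) = (M i j) • Matrix.single i j (1 : ℂ) := by
    rw [Matrix.smul_single, smul_eq_mul, mul_one]
  rw [this]
  refine Submodule.smul_mem _ _ (Submodule.subset_span ?_)
  refine ⟨List.replicate (n - (i : ℕ)) 0 ++ (1 :: List.replicate (j : ℕ) 0), ?_, ?_⟩
  · have hj := j.isLt
    simp only [List.length_append, List.length_replicate, List.length_cons]
    omega
  · rw [List.map_append, List.map_cons, List.prod_append, List.prod_cons, List.map_replicate,
      List.map_replicate, List.prod_replicate, List.prod_replicate]
    simp only [Matrix.cons_val_zero, Matrix.cons_val_one]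
    exact shift_word_eq_single N hN i j


end TightWindowsNeg

end Summit.MatrixMultiplication.MatrixMultiplication.Theorems
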